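import Mathlib
import Summits.NavierStokesRegularity.NavierStokesRegularity.Theorems.EulerZoomLiouvillePowerGaugeEulerLiouvillePressureSlavingUniqueness
import HarnessLib

/-!
# Crux E `PowerGaugeEulerLiouville` (stmt-NavierStokesRegularity-19832): the pressure inherits PAST-POINTING Euler symmetries of the velocity
# (time shifts `t₀ ≤ 0`), and the pressure of a LOG-TIME BREATHER velocity is breather-invariant a.e.
# (lane «pressure slaving»; consumers: the weak breather residue of line `logtime-breathers` (ns-ezl-w4 / ns-ezl-w5 notes); width seat ns-ezl-w3 g2)

Route `EulerZoomLiouville` (NavierStokesRegularity), crux E.  `PressureSlaving.pressure_ae_eq_stPull_of_velocity_fixed` (`…PressureSlavingUniqueness`) treats the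
slab-preserving rescalings `(s, y) ↦ (β s, x₀ + γ y)`.  Euler is also invariant under TIME SHIFTS, and a shift INTO THE PAST (`t₀ ≤ 0`) maps the slab
`(−∞,0) × ℝ³` into itself, so the same uniqueness argument applies one-sidedly:

* `PressureSlaving.pressure_ae_eq_stPull_of_velocity_fixed_shift` — if `α u(t₀ + β s, x₀ + γ y) = u(s, y)` on the slab for some `α, γ > 0`, `β = α γ`,
  `t₀ ≤ 0`, `x₀`, and `p` has the `D`-type growth (`m < 3`), then `p(s, y) = α² p(t₀ + β s, x₀ + γ y)` for a.e. `(s, y)` in the slab;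
* `PressureSlaving.breather_pressure_ae_invariant` — for a LOG-TIME BREATHER velocity `u τ y = e^{cτ} V(e^{−cτ} y)` (`τ < 0`; the clause of
  `IsTameBreather`, any real `c`) the pressure satisfies `p(s, y) = e^{−2ch} p(s + h, e^{ch} y)` a.e. on the slab for EVERY `h ≤ 0` (the breather group
  `(α, β, γ, t₀) = (e^{−ch}, 1, e^{ch}, h)` fixes `u`).  This is the invariance half of «breather pressure slaving»; the extraction of a breather pressure
  profile `p(s) = e^{2cs} Q(e^{−cs} ·)` is the additive analogue of `…PastProfile` (not typed here).

WHAT THIS IS NOT: not NS regularity, not the crux E — a structural lemma on the crux CLASS 19832 (MODEL lattice); `--supports` stmt-19832.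
[folklore; CaffarelliKohnNirenberg1982 §2; RusinSverak2011 §2 p. 4]
-/

noncomputable section

-- flat `Theorems/<Route><Decl>…` files of one crux share the namespace of the crux (tree convention: `Summit.<S>.<S>.…`)
set_option linter.dupNamespace false

open MeasureTheory Set Filter Topology Metric Function TopologicalSpace
open scoped ENNReal NNReal

namespace Summit.NavierStokesRegularity.NavierStokesRegularity.Theorems.PowerGaugeEulerLiouville

open Literature.Analysis Literature.Analysis.FunctionSpaces Literature.Analysis.FluidPDE

namespace PressureSlaving

/-- `Q_a(0) ⊆ Φ⁻¹ Q_{L a}(0)` for the past-pointing rescaling `Φ(s, y) = (t₀ + β s, x₀ + γ y)` (`β, γ > 0`, `t₀ ≤ 0`, `a ≥ 1`),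
`L = β + γ + ‖x₀‖ + |t₀| + 1`. [folklore] -/
theorem parabolicCylinder_subset_preimage_shiftTranslate {β γ t₀ a : ℝ} (hβ : 0 < β) (hγ : 0 < γ) (ht₀ : t₀ ≤ 0)
    (x₀ : EuclideanSpace ℝ (Fin 3)) (ha : 1 ≤ a) :
    parabolicCylinder a (0 : ℝ × EuclideanSpace ℝ (Fin 3)) ⊆
      stAffine β γ t₀ x₀ ⁻¹' parabolicCylinder ((β + γ + ‖x₀‖ + |t₀| + 1) * a) (0 : ℝ × EuclideanSpace ℝ (Fin 3)) := by
  rintro ⟨t, x⟩ hz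
  rw [mem_parabolicCylinder] at hz
  simp only [Prod.fst_zero, Prod.snd_zero, zero_sub, dist_zero_right] at hz
  rw [mem_preimage, mem_parabolicCylinder]
  simp only [stAffine_fst, stAffine_snd, Prod.fst_zero, Prod.snd_zero, zero_sub, dist_zero_right]
  obtain ⟨⟨ht1, ht2⟩, hx⟩ := hz
  have hx0 : 0 ≤ ‖x₀‖ := norm_nonneg _
  have hT : |t₀| = -t₀ := abs_of_nonpos ht₀
  have hT0 : 0 ≤ |t₀| := abs_nonneg _
  refine ⟨⟨?_, by nlinarith⟩, ?_⟩
  · have h1 : -(β * a ^ 2) < β * t := by nlinarith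
    have h2 : β * a ^ 2 + |t₀| ≤ ((β + γ + ‖x₀‖ + |t₀| + 1) * a) ^ 2 := by
      nlinarith [sq_nonneg a, sq_nonneg (β + γ + ‖x₀‖ + |t₀|), hβ.le, hγ.le, hx0, hT0,
        mul_nonneg hT0 (by linarith : (0 : ℝ) ≤ a - 1), mul_nonneg hT0 (by linarith : (0 : ℝ) ≤ a)]
    linarith
  · calc ‖x₀ + γ • x‖ ≤ ‖x₀‖ + ‖γ • x‖ := norm_add_le _ _
      _ = ‖x₀‖ + γ * ‖x‖ := by rw [norm_smul, Real.norm_eq_abs, abs_of_pos hγ]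
      _ < ‖x₀‖ + γ * a := by nlinarith
      _ ≤ (β + γ + ‖x₀‖ + |t₀| + 1) * a := by nlinarith

/-- **THE PRESSURE INHERITS PAST-POINTING EULER SYMMETRIES OF THE VELOCITY (a.e.).**  Let `(u, p)` be a distributional Euler solution (no force) on
`(−∞,0) × ℝ³` with the `D`-type growth `∫∫_{Q_a(0)}|p|^{3/2} ≤ K a^m` (`a ≥ a₀`, `K < ∞`, `m < 3`); let `α, γ > 0`, `β = α γ`, `t₀ ≤ 0`, `x₀ ∈ ℝ³`.  If
`α u(t₀ + β s, x₀ + γ y) = u(s, y)` for `s < 0`, then `p(s, y) = α² p(t₀ + β s, x₀ + γ y)` for a.e. `(s, y)` in the slab. [folklore; CaffarelliKohnNirenberg1982 §2] -/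
theorem pressure_ae_eq_stPull_of_velocity_fixed_shift {α β γ t₀ : ℝ} (hα : 0 < α) (hγ : 0 < γ) (hβ : β = α * γ) (ht₀ : t₀ ≤ 0)
    (x₀ : EuclideanSpace ℝ (Fin 3))
    {u : ℝ → EuclideanSpace ℝ (Fin 3) → EuclideanSpace ℝ (Fin 3)} {p : ℝ → EuclideanSpace ℝ (Fin 3) → ℝ}
    (hdist : IsDistributionalNSSolutionOn (slab (EuclideanSpace ℝ (Fin 3)) (Iio 0) isOpen_Iio) 0 0 u p)
    {K : ℝ≥0∞} (hK : K ≠ ⊤) {m a₀ : ℝ} (hm : m < 3)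
    (hD : ∀ a : ℝ, a₀ ≤ a →
      ∫⁻ z in parabolicCylinder a (0 : ℝ × EuclideanSpace ℝ (Fin 3)), ‖p z.1 z.2‖ₑ ^ (3 / 2 : ℝ) ≤ K * ENNReal.ofReal (a ^ m))
    (hfix : ∀ z : ℝ × EuclideanSpace ℝ (Fin 3), z.1 < 0 → (α • stPull β γ t₀ x₀ u) z.1 z.2 = u z.1 z.2) :
    ∀ᵐ z ∂(volume.restrict (Iio (0 : ℝ) ×ˢ (univ : Set (EuclideanSpace ℝ (Fin 3))))),
      p z.1 z.2 = α ^ 2 * p (t₀ + β * z.1) (x₀ + γ • z.2) := by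
  have hβ0 : 0 < β := by rw [hβ]; positivity
  -- the slab is mapped into itself
  have hle : slab (EuclideanSpace ℝ (Fin 3)) (Iio 0) isOpen_Iio ≤
      stPreimage β γ t₀ x₀ (slab (EuclideanSpace ℝ (Fin 3)) (Iio 0) isOpen_Iio) := by
    intro z hz
    have hz1 : z.1 < 0 := mem_slab.1 hz
    rw [mem_stPreimage, mem_slab, stAffine_fst, mem_Iio]
    nlinarith
  -- the rescaled pair, same velocity
  set q : ℝ → EuclideanSpace ℝ (Fin 3) → ℝ := α ^ 2 • stPull β γ t₀ x₀ p with hqdef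
  have hq : IsDistributionalNSSolutionOn (slab (EuclideanSpace ℝ (Fin 3)) (Iio 0) isOpen_Iio) 0 0 u q := by
    have h := hdist.stRescale hα hγ hβ t₀ x₀
    rw [mul_zero, zero_div] at h
    have h0 : (α ^ 2 * γ) • stPull β γ t₀ x₀ (0 : ℝ → EuclideanSpace ℝ (Fin 3) → EuclideanSpace ℝ (Fin 3)) = 0 := by
      funext s y
      rw [smul_stPull_apply]
      simp
    rw [h0] at h
    refine (h.of_le hle).congr_ae ?_ (ae_of_all _ fun _ => rfl)
    rw [coe_slab]
    filter_upwards [ae_restrict_mem (measurableSet_Iio.prod MeasurableSet.univ)] with z hz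
    exact hfix z (mem_prod.1 hz).1
  -- the growth of `q`
  set L : ℝ := β + γ + ‖x₀‖ + |t₀| + 1 with hL
  have hL1 : 1 ≤ L := by rw [hL]; linarith [hβ0.le, hγ.le, norm_nonneg x₀, abs_nonneg t₀]
  set Kβ : ℝ≥0∞ := ‖α ^ 2‖ₑ ^ (3 / 2 : ℝ) * ENNReal.ofReal (β * γ ^ Module.finrank ℝ (EuclideanSpace ℝ (Fin 3)))⁻¹ with hKβ
  have hKβtop : Kβ ≠ ⊤ :=
    ENNReal.mul_ne_top (ENNReal.rpow_ne_top_of_nonneg (by norm_num) enorm_ne_top) ENNReal.ofReal_ne_top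
  have hDq : ∀ a : ℝ, max a₀ 1 ≤ a →
      ∫⁻ z in parabolicCylinder a (0 : ℝ × EuclideanSpace ℝ (Fin 3)), ‖q z.1 z.2‖ₑ ^ (3 / 2 : ℝ) ≤
        (Kβ * K * ENNReal.ofReal (L ^ m)) * ENNReal.ofReal (a ^ m) := by
    intro a ha
    have ha₀ : a₀ ≤ a := (le_max_left _ _).trans ha
    have ha1 : 1 ≤ a := (le_max_right _ _).trans ha
    have ha0 : 0 < a := one_pos.trans_le ha1
    calc ∫⁻ z in parabolicCylinder a (0 : ℝ × EuclideanSpace ℝ (Fin 3)), ‖q z.1 z.2‖ₑ ^ (3 / 2 : ℝ)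
        ≤ ∫⁻ z in stAffine β γ t₀ x₀ ⁻¹' parabolicCylinder (L * a) (0 : ℝ × EuclideanSpace ℝ (Fin 3)), ‖q z.1 z.2‖ₑ ^ (3 / 2 : ℝ) :=
          lintegral_mono_set (parabolicCylinder_subset_preimage_shiftTranslate hβ0 hγ ht₀ x₀ ha1)
      _ = Kβ * ∫⁻ z in parabolicCylinder (L * a) (0 : ℝ × EuclideanSpace ℝ (Fin 3)), ‖p z.1 z.2‖ₑ ^ (3 / 2 : ℝ) := by
          rw [hqdef, setLIntegral_enorm_rpow_stRescale hβ0 hγ t₀ x₀ _ p _ (by norm_num), hKβ]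
      _ ≤ Kβ * (K * ENNReal.ofReal ((L * a) ^ m)) := by
          gcongr
          exact hD _ (ha₀.trans (by nlinarith))
      _ = (Kβ * K * ENNReal.ofReal (L ^ m)) * ENNReal.ofReal (a ^ m) := by
          rw [Real.mul_rpow (by linarith) ha0.le, ENNReal.ofReal_mul (Real.rpow_nonneg (by linarith) _)]
          ring
  have hDp' : ∀ a : ℝ, max a₀ 1 ≤ a →
      ∫⁻ z in parabolicCylinder a (0 : ℝ × EuclideanSpace ℝ (Fin 3)), ‖p z.1 z.2‖ₑ ^ (3 / 2 : ℝ) ≤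
        (K + Kβ * K * ENNReal.ofReal (L ^ m)) * ENNReal.ofReal (a ^ m) := fun a ha =>
    (hD a ((le_max_left _ _).trans ha)).trans (by gcongr; exact le_self_add)
  have hDq' : ∀ a : ℝ, max a₀ 1 ≤ a →
      ∫⁻ z in parabolicCylinder a (0 : ℝ × EuclideanSpace ℝ (Fin 3)), ‖q z.1 z.2‖ₑ ^ (3 / 2 : ℝ) ≤
        (K + Kβ * K * ENNReal.ofReal (L ^ m)) * ENNReal.ofReal (a ^ m) := fun a ha =>
    (hDq a ha).trans (by gcongr; exact le_add_self)
  have hKtot : K + Kβ * K * ENNReal.ofReal (L ^ m) ≠ ⊤ :=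
    ENNReal.add_ne_top.2 ⟨hK, ENNReal.mul_ne_top (ENNReal.mul_ne_top hKβtop hK) ENNReal.ofReal_ne_top⟩
  have h := pressure_ae_unique hdist hq hKtot hm hDp' hDq'
  filter_upwards [h] with z hz
  rw [hz, hqdef, smul_stPull_apply, smul_eq_mul]

/-- **THE PRESSURE OF A LOG-TIME BREATHER VELOCITY IS BREATHER-INVARIANT (a.e.).**  Let `(u, p)` be a distributional Euler solution (no force) on
`(−∞,0) × ℝ³` with the `D`-type growth, and let the velocity be a log-time breather, `u τ y = e^{cτ} V(e^{−cτ} y)` for `τ < 0` (the clause of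
`IsTameBreather`; any real `c`, any `V`).  Then for every `h ≤ 0`: `p(s, y) = e^{−2ch} p(s + h, e^{ch} y)` for a.e. `(s, y)` in the slab.
[folklore; CaffarelliKohnNirenberg1982 §2] -/
theorem breather_pressure_ae_invariant {c h : ℝ} (hh : h ≤ 0)
    {u : ℝ → EuclideanSpace ℝ (Fin 3) → EuclideanSpace ℝ (Fin 3)} {p : ℝ → EuclideanSpace ℝ (Fin 3) → ℝ}
    {V : EuclideanSpace ℝ (Fin 3) → EuclideanSpace ℝ (Fin 3)}
    (hdist : IsDistributionalNSSolutionOn (slab (EuclideanSpace ℝ (Fin 3)) (Iio 0) isOpen_Iio) 0 0 u p)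
    {K : ℝ≥0∞} (hK : K ≠ ⊤) {m a₀ : ℝ} (hm : m < 3)
    (hD : ∀ a : ℝ, a₀ ≤ a →
      ∫⁻ z in parabolicCylinder a (0 : ℝ × EuclideanSpace ℝ (Fin 3)), ‖p z.1 z.2‖ₑ ^ (3 / 2 : ℝ) ≤ K * ENNReal.ofReal (a ^ m))
    (hu : ∀ τ : ℝ, τ < 0 → ∀ y : EuclideanSpace ℝ (Fin 3), u τ y = Real.exp (c * τ) • V (Real.exp (-(c * τ)) • y)) :
    ∀ᵐ z ∂(volume.restrict (Iio (0 : ℝ) ×ˢ (univ : Set (EuclideanSpace ℝ (Fin 3))))),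
      p z.1 z.2 = Real.exp (-(c * h)) ^ 2 * p (z.1 + h) (Real.exp (c * h) • z.2) := by
  have hα : 0 < Real.exp (-(c * h)) := Real.exp_pos _
  have hγ : 0 < Real.exp (c * h) := Real.exp_pos _
  have hβ : (1 : ℝ) = Real.exp (-(c * h)) * Real.exp (c * h) := by
    rw [← Real.exp_add, show -(c * h) + c * h = 0 by ring, Real.exp_zero]
  have hfix : ∀ z : ℝ × EuclideanSpace ℝ (Fin 3), z.1 < 0 →
      (Real.exp (-(c * h)) • stPull 1 (Real.exp (c * h)) h (0 : EuclideanSpace ℝ (Fin 3)) u) z.1 z.2 = u z.1 z.2 := by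
    intro z hz
    have hzh : h + 1 * z.1 < 0 := by linarith
    rw [smul_stPull_apply, zero_add, hu _ hzh, hu _ hz, smul_smul, smul_smul]
    have e1 : Real.exp (-(c * h)) * Real.exp (c * (h + 1 * z.1)) = Real.exp (c * z.1) := by
      rw [← Real.exp_add]; congr 1; ring
    have e2 : Real.exp (-(c * (h + 1 * z.1))) * Real.exp (c * h) = Real.exp (-(c * z.1)) := by
      rw [← Real.exp_add]; congr 1; ring
    rw [e1, e2]
  have h1 := pressure_ae_eq_stPull_of_velocity_fixed_shift hα hγ hβ hh (0 : EuclideanSpace ℝ (Fin 3)) hdist hK hm hD hfix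
  filter_upwards [h1] with z hz
  rw [hz, one_mul, zero_add, add_comm]

end PressureSlaving

end Summit.NavierStokesRegularity.NavierStokesRegularity.Theorems.PowerGaugeEulerLiouville

end
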